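import Summits.ResolutionOfSingularities.ResolutionOfSingularities.Theorems.FrobeniusClosingSteerMemberDimension
import Summits.ResolutionOfSingularities.ResolutionOfSingularities.Theorems.ValuativeLuAlphaPTorsorLocAtCentreDerivations
import Literature.AlgebraicGeometry.Resolution.RegularSystemOfParameters
import HarnessLib

/-!
# Crux `Steer` (stmt-ResolutionOfSingularities-16345), chain W4.1 — σ-residual LOW at `p = 2`: **every member of a steered run
# carries a coordinate system with DUAL DERIVATIONS** (the §σ2.23 input `MembersDualDerivationsTwoN`, helper form)

OURS (campaign `res-hironaka`, rung L, slot W4.1, chain W4.1; replaces the role of no printed item; NOT a statement of the manuscript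
under review [claim: Hironaka2017, status: under-review]; AI review is weaker than expert review).  Theses-free, definition-free helper for
res-L0-w41-strat-2's §σ2.23 Prop `MembersDualDerivationsTwoN` (`LowLipman-s23-strat2.r27.delta.lean` 84c6d5223e9f6f0e, folded in the holder's
r29): for a tower `R 0 = (A₀)_{𝔪_O ∩ A₀} → R 1 → ⋯` of LOCAL BLOWINGS UP with respect to a valuation ring `O` zero-dimensional over `k`, starting
at a finitely generated model of a function field of transcendence degree `4`, every REGULAR member `R N` has a 4-tuple `y` generating `𝔪_{R N}`
and `ℤ`-derivations `D a` with `D a (y b) = δ_{ab}` — the body of strat-2's `HasDualDerivations (R N)`, UNFOLDED verbatim.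

## Proof (namespace `…Theorems.SwitchingDichotomy.MemberDualDerivations`) — assembly of tree theorems only

* `SteeredExit.exists_model_of_tower` (p502?/W4.1): `R N = (A₁)_{𝔪_O ∩ A₁}` for a finitely generated model `A₀ ≤ A₁ ⊆ O`;
* `TailCodim.ringKrullDim_member_eq` (K-T1, `…SteerMemberDimension`): `dim R N = trdeg_k K = 4` (closed centre: `O` zero-dimensional);
* `exists_regularSystemOfParameters` + `IsRegularLocalRing.spanFinrank_maximalIdeal`: a regular system of parameters `y : Fin 4 → R N`;
* `PfaffLine.exists_dual_derivations_locAtCentre` (`…ValuativeLuAlphaPTorsorLocAtCentreDerivations`): dual derivations for any such `y` at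
  the local ring of a finitely generated model at the centre of `O` (no perfectness / separability hypothesis is needed there).

No named facts, no definitions, no `sorry`. [cite: Matsumura1987, Thm. 30.6 (context: dual bases of derivations)]
[cite: NovacoskiSpivakovsky2014, Def. 2.8, Lemma 2.9 (towers of local blowings up)] [folklore]
-/

noncomputable section

-- `Summit.<S>.<S>.…` duplicates the summit name by design (single-problem summit).
set_option linter.dupNamespace false
set_option autoImplicit false

namespace Summit.ResolutionOfSingularities.ResolutionOfSingularities.Theorems.SwitchingDichotomy.MemberDualDerivations

open IsLocalRing
open Literature.AlgebraicGeometry.Resolution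
open Summit.ResolutionOfSingularities.ResolutionOfSingularities.Theorems.SwitchingDichotomy
  (SteeredExit.exists_model_of_tower TailCodim.ringKrullDim_member_eq)
open Summit.ResolutionOfSingularities.ResolutionOfSingularities.Theorems.PfaffLine (exists_dual_derivations_locAtCentre)

variable {k K : Type} [Field k] [Field K] [Algebra k K]

/-- **Dual derivations at the local ring of a finitely generated model at the centre of `O`, in dimension `d`** (re-indexing of
`PfaffLine.exists_dual_derivations_locAtCentre` to `Fin d` from `ringKrullDim = d`): a regular `S = (A₁)_{𝔪_O ∩ A₁}` of dimension `d`
(`A₁` finitely generated over `k`, characteristic `p`) has a regular system of parameters `y : Fin d → S` with dual `ℤ`-derivations.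
[cite: Matsumura1987, Thm. 30.6] [folklore] -/
theorem exists_rsop_dual_derivations_locAtCentre (p : ℕ) [Fact p.Prime] [CharP k p]
    (O : ValuationSubring K) (A₁ : Subalgebra k K) (h₁ : A₁.toSubring ≤ O.toSubring) (hfg : A₁.FG)
    (hreg : IsRegularLocalRing (locAtCentre A₁.toSubring O)) {d : ℕ}
    (hdim : ringKrullDim (locAtCentre A₁.toSubring O) = (d : WithBot ℕ∞)) :
    ∃ (y : Fin d → locAtCentre A₁.toSubring O)
      (D : Fin d → Derivation ℤ (locAtCentre A₁.toSubring O) (locAtCentre A₁.toSubring O)),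
      Ideal.span (Set.range y) = maximalIdeal (locAtCentre A₁.toSubring O) ∧ ∀ a b, D a (y b) = if a = b then 1 else 0 := by
  haveI := hreg
  -- a regular system of parameters, re-indexed by `Fin d`
  obtain ⟨x, hx⟩ := exists_regularSystemOfParameters (R := locAtCentre A₁.toSubring O)
  have hd : (maximalIdeal (locAtCentre A₁.toSubring O)).spanFinrank = d := by
    have h := IsRegularLocalRing.spanFinrank_maximalIdeal (R := locAtCentre A₁.toSubring O)
    rw [hdim] at h
    exact_mod_cast h
  let y : Fin d → locAtCentre A₁.toSubring O := x ∘ finCongr hd.symm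
  have hy : Ideal.span (Set.range y) = maximalIdeal (locAtCentre A₁.toSubring O) := by
    rw [show Set.range y = Set.range x from (finCongr hd.symm).surjective.range_comp x, hx]
  obtain ⟨D, hD⟩ := exists_dual_derivations_locAtCentre p k K O A₁ h₁ hfg y hy hdim
  exact ⟨y, D, hy, hD⟩

/-- **`HasDualDerivations (R N)` for every regular member of a tower of local blowings up** (strat-2's §σ2.23 `MembersDualDerivationsTwoN`,
helper form; conclusion = the body of `HasDualDerivations (R N)` verbatim).  Hypotheses = the core-datum rows the in-skeleton leaf unpacks:
`A₀` finitely generated, `t ^ p ∈ A₀` (`0 < p`), `Frac(A₀[t]) = K`, `O` zero-dimensional over `k` (unfolded), `trdeg_k K = 4`; the tower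
`R 0 = locAtCentre A₀.toSubring O`, `IsLocalBlowup O (R i) (R (i+1))` for `i < N` (from `IsSteeredRun` by `IsLocalBlowupAlong.isLocalBlowup`);
and `R N` regular (the chain's `steeredMembersRegular_holds`). [cite: Matsumura1987, Thm. 30.6] [cite: NovacoskiSpivakovsky2014, Def. 2.8, Lemma 2.9]
[folklore] -/
theorem hasDualDerivations_member (p : ℕ) [Fact p.Prime] [CharP k p]
    (O : ValuationSubring K) (A₀ : Subalgebra k K) (h₀ : A₀.toSubring ≤ O.toSubring) (t : K)
    (hfg : A₀.FG) (htp : t ^ p ∈ A₀)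
    (hfr : IsFractionRing (Algebra.adjoin k (insert t (A₀ : Set K))) K)
    (hzd : ∀ x ∈ O, ∃ f : Polynomial k, f ≠ 0 ∧ Polynomial.aeval x f ∈ O.nonunits)
    (htr : Algebra.trdeg k K = (4 : Cardinal))
    (R : ℕ → Subring K) (hR0 : R 0 = locAtCentre A₀.toSubring O) (N : ℕ)
    (hst : ∀ i < N, IsLocalBlowup O (R i) (R (i + 1))) (hreg : IsRegularLocalRing (R N)) :
    ∃ (_ : IsLocalRing (R N)) (y : Fin 4 → R N) (D : Fin 4 → Derivation ℤ (R N) (R N)),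
      Ideal.span (Set.range y) = IsLocalRing.maximalIdeal (R N) ∧ ∀ a b, D a (y b) = if a = b then 1 else 0 := by
  have hp : 0 < p := (Fact.out : p.Prime).pos
  -- dimension of the member
  have hdimN : ringKrullDim (R N) = (4 : ℕ) :=
    TailCodim.ringKrullDim_member_eq k K O A₀ h₀ t hp hfg htp hfr hzd (n := 4) (by exact_mod_cast htr) R N hR0 hst
  -- a finitely generated model with `locAtCentre A₁ O = R N`
  obtain ⟨A₁, h₁, -, hfg₁, hRN⟩ := SteeredExit.exists_model_of_tower O A₀ h₀ hfg hR0 hst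
  have hreg₁ : IsRegularLocalRing (locAtCentre A₁.toSubring O) := by rw [hRN]; exact hreg
  have hdim₁ : ringKrullDim (locAtCentre A₁.toSubring O) = ((4 : ℕ) : WithBot ℕ∞) := by rw [hRN]; exact hdimN
  obtain ⟨y, D, hy, hD⟩ := exists_rsop_dual_derivations_locAtCentre p O A₁ h₁ hfg₁ hreg₁ hdim₁
  rw [← hRN]
  exact ⟨inferInstance, y, D, hy, hD⟩

end Summit.ResolutionOfSingularities.ResolutionOfSingularities.Theorems.SwitchingDichotomy.MemberDualDerivations
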